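import Summits.QuantumFields.YangMills.Theorems.BalabanUVNodesN15BackgroundV1TwoSidedLetters
import Summits.QuantumFields.YangMills.Theorems.BalabanUVNodesN15BackgroundV1CoarseTriple
import HarnessLib

/-!
# THE FIVE GAUGE LETTERS OF THE PAIR (FINE FIELD, ITS BLOCK MEAN) FROM THE UNIT-SCALE C² LETTERS OF THE FINE FIELD — and hence the fifteen `TwoSidedLetters` of the two-sided by-parts
# layer for Bałaban's species (3.52) with the COARSE coefficients read from the MEAN FIELD `Ā = gavgM π A′` (dag-n15-c g9, FILE 26; Track-A node N15 = NE2, s1 «background-layer OPERATOR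
# ingredient»)

`--kind proof --supports stmt-QuantumFields-20544 --as helper` (K3⁷; count-neutral; theorems only).  Imports BY NAME this seat's FILE 25 `…BackgroundV1TwoSidedLetters` (★★
`twoSidedLetters_of_gauge`, `TwoSidedLetters`), g4 `…BackgroundV1CoarseTriple` (`blockAvgV_translate`, `blockAvgV_sub'`, `blockAvgV_smul'`, `norm_powSymm_sub_le`, `norm_powSymm_sub_nsmul_le`),
g1∕13c (`gavgM`, `blockAvgV`, `fit_blockAvgV`, `norm_blockAvgV_le`); nothing in the tree is modified.

WHAT.  §1 `powSymm_comm` (commuting unit shifts: `(T^N)⁻¹∘s′_κ = s′_κ∘(T^N)⁻¹`); ★ `meanLetters_component`: for one `E`-valued field `f` on the fine lattice with sup `≤ r`, one-step letters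
`≤ rη′` (all directions) and the second-difference letter `‖Δ_κf − (Δ_κf)∘T⁻¹‖ ≤ rη′²` (`T = s′_μ`), under COMMUTING shifts, `C_π`-STEP-CONNECTED pairing fibres and the BLOCK-TRANSLATION LAW
`π∘T^N = σ∘π` (`η = Nη′ > 0`): the block mean `f̄ = blockAvgV π f` has sup `≤ r`, own-direction one-step letter `‖f̄ − f̄∘σ⁻¹‖ ≤ rη`, fit `‖f − f̄∘π‖ ≤ C_πrη′`, translated fit
`‖f∘T⁻¹ − f̄∘σ⁻¹∘π‖ ≤ rη + rη′ + C_πrη′`, DERIVATIVE FIT `‖η′⁻¹(f − f∘T⁻¹) − η⁻¹(f̄ − f̄∘σ⁻¹)∘π‖ ≤ rη + C_πrη′` (telescoping `N` backward quotients against the first one, g4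
`norm_powSymm_sub_nsmul_le`; the averaged quotient's one-step letters are the second differences, then the fibre fit).  §2 ★★ `gaugeLetters_of_mean`: the five gauge letters of FILE 25 for
`(A′, gavgM π A′)`.  §3 ★★★ `twoSidedLetters_of_meanGauge`: with `η ≤ min(1, θ)`, `C_πη′ ≤ C₀θ` and the window `2(1+|J|)(3+C₀)r ≤ 1`:
`TwoSidedLetters J ι π s s′ η⁻¹ η′⁻¹ (14e(1+|J|)κ_e·((1+|J|)(3+C₀)r)) θ (c′, a′)(A′) (c, a)(Ā)`.

WHY.  This is the letter bundle FILE 24's node theorem ★★★ `ne2PlusOperator_twoSided_of_letters` consumes, for the pairing's OWN coarse configuration (the block mean): Bałaban's (3.52) with both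
bond orientations, coarse `V′₁` built from the coarse field, fine `V′₁` from the fine field.

HONEST FRAMING.  Block means = linearised (C3) transport; unit-scale reading of (3.35)–(3.36); crude constants; nothing about `G(U)` asserted; NE2⁺ NOT PRINTED; N15 not discharged; nothing
continuum ∕ OS ∕ mass-gap ∕ Clay.
-/

noncomputable section

open scoped BigOperators
open Finset

namespace Summit.QuantumFields.YangMills.BalabanUVNodes.N15.BackgroundLayer

open Literature.MathematicalPhysics.QuantumFieldTheory.Balaban1983to89.T4EtaRateCoeffDefect (fibre mem_fibre)
open Summit.QuantumFields.YangMills.BalabanUVNodes.N15.MatrixSpecies (basisConst basisConst_nonneg blockAvgV fit_blockAvgV norm_blockAvgV_le)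

/-! ## §1 One component: the five letters of (field, block mean) -/

section Component

variable {X X' J E : Type} [Fintype X'] [DecidableEq X] [NormedAddCommGroup E] [NormedSpace ℝ E]

omit [Fintype X'] [DecidableEq X] [NormedAddCommGroup E] [NormedSpace ℝ E] in
/-- Commuting unit shifts: `(T^N)⁻¹ (s′_κ x) = s′_κ ((T^N)⁻¹ x)` for `T = s′_μ`. [folklore] -/
theorem powSymm_comm {s' : J → X' ≃ X'} (hcomm : ∀ μ κ x, (s' μ).symm (s' κ x) = s' κ ((s' μ).symm x)) (μ κ : J) :
    ∀ (N : ℕ) (x : X'), (s' μ ^ N).symm (s' κ x) = s' κ ((s' μ ^ N).symm x) := by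
  intro N
  induction N with
  | zero => intro x; rfl
  | succ N ih =>
      intro x
      have hstep : ∀ z, (s' μ ^ (N + 1)).symm z = (s' μ ^ N).symm ((s' μ).symm z) := fun z => by
        rw [pow_succ', Equiv.Perm.mul_def, Equiv.symm_trans_apply]
      rw [hstep, hstep, hcomm, ih]

/-- ★ **THE FIVE LETTERS OF (FIELD, BLOCK MEAN) FROM THE C² LETTERS OF THE FIELD.**  `f : X′ → E` with sup `≤ r`, one-step letters `‖f∘s′_κ − f‖ ≤ rη′`, second-difference letter
`‖(f∘s′_κ − f) − (f∘s′_κ − f)∘T⁻¹‖ ≤ rη′²` (`T = s′_μ`); commuting shifts, `C_π`-step-connected fibres, block-translation law `π∘T^N = σ∘π`, `η = Nη′ > 0`.  Then for `f̄ = blockAvgV π f`: sup `≤ r`;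
`‖f̄ − f̄∘σ⁻¹‖ ≤ rη`; `‖f − f̄∘π‖ ≤ C_πrη′`; `‖f∘T⁻¹ − f̄∘σ⁻¹∘π‖ ≤ rη + rη′ + C_πrη′`; `‖η′⁻¹(f − f∘T⁻¹) − η⁻¹(f̄ − f̄∘σ⁻¹)∘π‖ ≤ rη + C_πrη′`.
[cite: Balaban1985BackgroundPropagators, (3.35)–(3.36) p.396 (shapes); King1986, p.664 (pairing convention)] -/
theorem meanLetters_component {π : X' → X} {s' : J → X' ≃ X'} {μ : J} {σ : X ≃ X} {N : ℕ} {η η' r Cπ : ℝ}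
    (hcomm : ∀ μ κ x, (s' μ).symm (s' κ x) = s' κ ((s' μ).symm x))
    (hconn : ∀ (f : X' → E) (β : ℝ), (∀ κ x, ‖f (s' κ x) - f x‖ ≤ β) → ∀ x₁ x₂, π x₁ = π x₂ → ‖f x₁ - f x₂‖ ≤ Cπ * β)
    (hblk : ∀ x', π ((s' μ ^ N) x') = σ (π x')) (hη' : 0 < η') (hN : η = N * η') (hη : 0 < η) (hr : 0 ≤ r)
    {f : X' → E} (hsup : ∀ x', ‖f x'‖ ≤ r) (hstep : ∀ κ x', ‖f (s' κ x') - f x'‖ ≤ r * η')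
    (hsec : ∀ κ x', ‖(f (s' κ x') - f x') - (f (s' κ ((s' μ).symm x')) - f ((s' μ).symm x'))‖ ≤ r * η' * η') :
    (∀ y, ‖blockAvgV π f y‖ ≤ r) ∧ (∀ y, ‖blockAvgV π f y - blockAvgV π f (σ.symm y)‖ ≤ r * η) ∧
      (∀ x', ‖f x' - blockAvgV π f (π x')‖ ≤ Cπ * (r * η')) ∧
      (∀ x', ‖f ((s' μ).symm x') - blockAvgV π f (σ.symm (π x'))‖ ≤ r * η + r * η' + Cπ * (r * η')) ∧
      (∀ x', ‖η'⁻¹ • (f x' - f ((s' μ).symm x')) - η⁻¹ • (blockAvgV π f (π x') - blockAvgV π f (σ.symm (π x')))‖ ≤ r * η + Cπ * (r * η')) := by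
  have hrη' : 0 ≤ r * η' := mul_nonneg hr hη'.le
  have hNpos : (0 : ℝ) < N := by
    rcases Nat.eq_zero_or_pos N with h0 | hpos
    · exfalso; rw [hN, h0] at hη; simp at hη
    · exact_mod_cast hpos
  -- the backward one-step letter along `T = s′_μ` and the translate by `T^N`
  have hback : ∀ z, ‖f ((s' μ).symm z) - f z‖ ≤ r * η' := fun z => by
    rw [norm_sub_rev]; simpa only [Equiv.apply_symm_apply] using hstep μ ((s' μ).symm z)
  have hpow : ∀ x', ‖f ((s' μ ^ N).symm x') - f x'‖ ≤ N * (r * η') := norm_powSymm_sub_le (s' μ) hback N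
  have hNrη : (N : ℝ) * (r * η') = r * η := by rw [hN]; ring
  -- (1) sup, (2) own-direction one-step letter of the mean
  have h1 : ∀ y, ‖blockAvgV π f y‖ ≤ r := fun y => norm_blockAvgV_le π hr hsup y
  have h2 : ∀ y, ‖blockAvgV π f y - blockAvgV π f (σ.symm y)‖ ≤ r * η := fun y => by
    rw [blockAvgV_translate π (s' μ ^ N) σ hblk f y, ← blockAvgV_sub']
    refine norm_blockAvgV_le π (by positivity) (fun x' => ?_) y
    rw [norm_sub_rev]; exact (hpow x').trans hNrη.le
  -- (3) fit through the step-connectivity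
  have h3 : ∀ x', ‖f x' - blockAvgV π f (π x')‖ ≤ Cπ * (r * η') := fun x' =>
    fit_blockAvgV π (Ω := fun _ => Cπ * (r * η')) (fun x₁ x₂ hx => hconn f (r * η') hstep x₁ x₂ hx) x'
  -- (4) translated fit: the translate `g = f∘(T^N)⁻¹` has the same one-step letters (commuting shifts)
  have hg : ∀ κ x, ‖f ((s' μ ^ N).symm (s' κ x)) - f ((s' μ ^ N).symm x)‖ ≤ r * η' := fun κ x => by
    rw [powSymm_comm hcomm μ κ N x]; exact hstep κ _
  have h4 : ∀ x', ‖f ((s' μ).symm x') - blockAvgV π f (σ.symm (π x'))‖ ≤ r * η + r * η' + Cπ * (r * η') := fun x' => by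
    rw [blockAvgV_translate π (s' μ ^ N) σ hblk f (π x')]
    have hfit := fit_blockAvgV π (a' := fun x => f ((s' μ ^ N).symm x)) (Ω := fun _ => Cπ * (r * η'))
      (fun x₁ x₂ hx => hconn (fun x => f ((s' μ ^ N).symm x)) (r * η') hg x₁ x₂ hx) x'
    calc ‖f ((s' μ).symm x') - blockAvgV π (fun x => f ((s' μ ^ N).symm x)) (π x')‖
        ≤ ‖f ((s' μ).symm x') - f ((s' μ ^ N).symm x')‖ + ‖f ((s' μ ^ N).symm x') - blockAvgV π (fun x => f ((s' μ ^ N).symm x)) (π x')‖ :=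
          norm_sub_le_norm_sub_add_norm_sub _ _ _
      _ ≤ (‖f ((s' μ).symm x') - f x'‖ + ‖f x' - f ((s' μ ^ N).symm x')‖) + Cπ * (r * η') := add_le_add (norm_sub_le_norm_sub_add_norm_sub _ _ _) hfit
      _ ≤ (r * η' + N * (r * η')) + Cπ * (r * η') := by
          gcongr
          · exact hback x'
          · rw [norm_sub_rev]; exact hpow x'
      _ = r * η + r * η' + Cπ * (r * η') := by rw [hNrη]; ring
  -- (5) derivative fit: the coarse backward quotient is the mean of `F = η⁻¹(f − f∘(T^N)⁻¹)`
  have h5 : ∀ x', ‖η'⁻¹ • (f x' - f ((s' μ).symm x')) - η⁻¹ • (blockAvgV π f (π x') - blockAvgV π f (σ.symm (π x')))‖ ≤ r * η + Cπ * (r * η') := by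
    intro x'
    set F : X' → E := fun x => η⁻¹ • (f x - f ((s' μ ^ N).symm x)) with hF
    have hmean : η⁻¹ • (blockAvgV π f (π x') - blockAvgV π f (σ.symm (π x'))) = blockAvgV π F (π x') := by
      rw [blockAvgV_translate π (s' μ ^ N) σ hblk f (π x'), ← blockAvgV_sub', ← blockAvgV_smul']
    -- `F − D`: `N` backward quotients against the first one
    have hFD : ‖η'⁻¹ • (f x' - f ((s' μ).symm x')) - F x'‖ ≤ r * η := by
      have key := norm_powSymm_sub_nsmul_le (s' μ) (f := f) (β₂ := r * η' * η') (by positivity) (fun z => by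
        simpa only [Equiv.apply_symm_apply] using hsec μ ((s' μ).symm z)) N x'
      have hNη : η'⁻¹ = η⁻¹ * N := by rw [hN]; field_simp
      have hrew : η'⁻¹ • (f x' - f ((s' μ).symm x')) - F x' = -(η⁻¹ • ((f x' - f ((s' μ ^ N).symm x')) - (N : ℝ) • (f x' - f ((s' μ).symm x')))) := by
        rw [hF, hNη, mul_smul]; simp only [smul_sub]; abel
      rw [hrew, norm_neg, norm_smul, Real.norm_eq_abs, abs_of_nonneg (inv_nonneg.2 hη.le)]
      calc η⁻¹ * ‖(f x' - f ((s' μ ^ N).symm x')) - (N : ℝ) • (f x' - f ((s' μ).symm x'))‖ ≤ η⁻¹ * ((N : ℝ) * N * (r * η' * η')) :=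
            mul_le_mul_of_nonneg_left key (inv_nonneg.2 hη.le)
        _ = r * η := by rw [hN]; field_simp
    -- the one-step letters of `F` are the second differences telescoped along `T`
    have hFstep : ∀ κ x, ‖F (s' κ x) - F x‖ ≤ r * η' := fun κ x => by
      have htel := norm_powSymm_sub_le (s' μ) (f := fun z => f (s' κ z) - f z) (β := r * η' * η') (fun z => by
        rw [norm_sub_rev]; exact hsec κ z) N x
      have hrew : F (s' κ x) - F x = -(η⁻¹ • ((f (s' κ ((s' μ ^ N).symm x)) - f ((s' μ ^ N).symm x)) - (f (s' κ x) - f x))) := by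
        rw [hF]; simp only [powSymm_comm hcomm μ κ N x, smul_sub]; abel
      rw [hrew, norm_neg, norm_smul, Real.norm_eq_abs, abs_of_nonneg (inv_nonneg.2 hη.le)]
      calc η⁻¹ * ‖(f (s' κ ((s' μ ^ N).symm x)) - f ((s' μ ^ N).symm x)) - (f (s' κ x) - f x)‖ ≤ η⁻¹ * (N * (r * η' * η')) :=
            mul_le_mul_of_nonneg_left htel (inv_nonneg.2 hη.le)
        _ = r * η' := by rw [hN]; field_simp
    have hFfit : ‖F x' - blockAvgV π F (π x')‖ ≤ Cπ * (r * η') :=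
      fit_blockAvgV π (Ω := fun _ => Cπ * (r * η')) (fun x₁ x₂ hx => hconn F (r * η') hFstep x₁ x₂ hx) x'
    rw [hmean]
    calc ‖η'⁻¹ • (f x' - f ((s' μ).symm x')) - blockAvgV π F (π x')‖
        ≤ ‖η'⁻¹ • (f x' - f ((s' μ).symm x')) - F x'‖ + ‖F x' - blockAvgV π F (π x')‖ := norm_sub_le_norm_sub_add_norm_sub _ _ _
      _ ≤ r * η + Cπ * (r * η') := add_le_add hFD hFfit
  exact ⟨h1, h2, h3, h4, h5⟩

end Component

/-! ## §2 The five gauge letters of `(A′, gavgM π A′)`; §3 the fifteen `TwoSidedLetters` -/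

section Gauge

variable {X X' J ι : Type} [Fintype X'] [DecidableEq X] [Fintype J] [Fintype ι] [DecidableEq ι] {𝔄 : Type} [NormedRing 𝔄] [NormedAlgebra ℝ 𝔄] [CompleteSpace 𝔄]
  (e : 𝔄 ≃L[ℝ] (ι → ℝ))

omit [Fintype J] [CompleteSpace 𝔄] in
/-- ★★ **THE FIVE GAUGE LETTERS OF (FINE FIELD, BLOCK MEAN)** (§1 componentwise, `T = s′_μ`, `σ = s_μ`): sups `≤ r`, own-direction one-step letters (`rη′`, `rη`), fit `≤ C_πrη′`, translated fit
`≤ rη + rη′ + C_πrη′`, derivative fit `≤ rη + C_πrη′`, for `Ā = gavgM π A′`. [cite: Balaban1985BackgroundPropagators, (3.35)–(3.36) p.396 (shapes); King1986, p.664] -/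
theorem gaugeLetters_of_mean {π : X' → X} {s : J → X ≃ X} {s' : J → X' ≃ X'} {N : ℕ} {η η' r Cπ : ℝ}
    (hcomm : ∀ μ κ x, (s' μ).symm (s' κ x) = s' κ ((s' μ).symm x))
    (hconn : ∀ (f : X' → 𝔄) (β : ℝ), (∀ κ x, ‖f (s' κ x) - f x‖ ≤ β) → ∀ x₁ x₂, π x₁ = π x₂ → ‖f x₁ - f x₂‖ ≤ Cπ * β)
    (hblk : ∀ μ x', π ((s' μ ^ N) x') = s μ (π x')) (hη' : 0 < η') (hN : η = N * η') (hη : 0 < η) (hr : 0 ≤ r) {A' : J → X' → 𝔄}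
    (h1 : ∀ μ x', ‖A' μ x'‖ ≤ r) (h2 : ∀ μ κ x', ‖A' μ (s' κ x') - A' μ x'‖ ≤ r * η')
    (h3 : ∀ μ κ x', ‖(A' μ (s' κ x') - A' μ x') - (A' μ (s' κ ((s' μ).symm x')) - A' μ ((s' μ).symm x'))‖ ≤ r * η' * η') :
    (∀ μ y, ‖gavgM 𝔄 J π A' μ y‖ ≤ r) ∧ (∀ μ x', ‖A' μ x' - A' μ ((s' μ).symm x')‖ ≤ r * η') ∧
      (∀ μ y, ‖gavgM 𝔄 J π A' μ y - gavgM 𝔄 J π A' μ ((s μ).symm y)‖ ≤ r * η) ∧ (∀ μ x', ‖A' μ x' - gavgM 𝔄 J π A' μ (π x')‖ ≤ Cπ * (r * η')) ∧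
      (∀ μ x', ‖A' μ ((s' μ).symm x') - gavgM 𝔄 J π A' μ ((s μ).symm (π x'))‖ ≤ r * η + r * η' + Cπ * (r * η')) ∧
      (∀ μ x', ‖η'⁻¹ • (A' μ x' - A' μ ((s' μ).symm x')) - η⁻¹ • (gavgM 𝔄 J π A' μ (π x') - gavgM 𝔄 J π A' μ ((s μ).symm (π x')))‖ ≤ r * η + Cπ * (r * η')) := by
  have H : ∀ μ, _ := fun μ => meanLetters_component (E := 𝔄) (μ := μ) (σ := s μ) hcomm hconn (hblk μ) hη' hN hη hr (h1 μ) (h2 μ) (h3 μ)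
  refine ⟨fun μ y => (H μ).1 y, fun μ x' => ?_, fun μ y => (H μ).2.1 y, fun μ x' => (H μ).2.2.1 x', fun μ x' => (H μ).2.2.2.1 x', fun μ x' => (H μ).2.2.2.2 x'⟩
  simpa only [Equiv.apply_symm_apply] using h2 μ μ ((s' μ).symm x')

/-- ★★★ **THE FIFTEEN `TwoSidedLetters` FOR BAŁABAN's SPECIES (3.52) OF A FINE GAUGE FIELD AND ITS BLOCK MEAN, FROM THE UNIT-SCALE C² LETTERS OF THE FINE FIELD.**  With `0 < η′`,
`η = Nη′ > 0`, `η ≤ min(1, θ)`, `C_πη′ ≤ C₀θ` and the window `2(1+|J|)(3+C₀)r ≤ 1`: FILE 25 ★★ `twoSidedLetters_of_gauge` at `r̂ = (3+C₀)r` fed with §2.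
[cite: Balaban1985BackgroundPropagators, (3.35)–(3.36) p.396, (3.52) p.400 (shapes); King1986, p.664] -/
theorem twoSidedLetters_of_meanGauge {π : X' → X} {s : J → X ≃ X} {s' : J → X' ≃ X'} {N : ℕ} {η η' r θ Cπ C₀ : ℝ}
    (hcomm : ∀ μ κ x, (s' μ).symm (s' κ x) = s' κ ((s' μ).symm x))
    (hconn : ∀ (f : X' → 𝔄) (β : ℝ), (∀ κ x, ‖f (s' κ x) - f x‖ ≤ β) → ∀ x₁ x₂, π x₁ = π x₂ → ‖f x₁ - f x₂‖ ≤ Cπ * β)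
    (hblk : ∀ μ x', π ((s' μ ^ N) x') = s μ (π x')) (hη' : 0 < η') (hN : η = N * η') (hη : 0 < η) (hη1 : η ≤ 1) (hηθ : η ≤ θ) (hC₀ : 0 ≤ C₀)
    (hCθ : Cπ * η' ≤ C₀ * θ) (hr : 0 ≤ r) (hr2 : 2 * ((1 + Fintype.card J) * ((3 + C₀) * r)) ≤ 1) {A' : J → X' → 𝔄}
    (h1 : ∀ μ x', ‖A' μ x'‖ ≤ r) (h2 : ∀ μ κ x', ‖A' μ (s' κ x') - A' μ x'‖ ≤ r * η')
    (h3 : ∀ μ κ x', ‖(A' μ (s' κ x') - A' μ x') - (A' μ (s' κ ((s' μ).symm x')) - A' μ ((s' μ).symm x'))‖ ≤ r * η' * η') :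
    TwoSidedLetters J ι π s s' η⁻¹ η'⁻¹ (14 * Real.exp 1 * (1 + Fintype.card J) * basisConst e * ((1 + Fintype.card J) * ((3 + C₀) * r))) θ
      (v1coefC e η' (v1fieldsOfGauge 𝔄 J s' η' A'), v1coefA e η' (v1fieldsOfGauge 𝔄 J s' η' A'))
      (v1coefC e η (v1fieldsOfGauge 𝔄 J s η (gavgM 𝔄 J π A')), v1coefA e η (v1fieldsOfGauge 𝔄 J s η (gavgM 𝔄 J π A'))) := by
  obtain ⟨g1, g2', g2, g3, g4, g5⟩ := gaugeLetters_of_mean hcomm hconn hblk hη' hN hη hr h1 h2 h3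
  have hNpos : (1 : ℝ) ≤ N := by
    rcases Nat.eq_zero_or_pos N with h0 | hpos
    · exfalso; rw [hN, h0] at hη; simp at hη
    · exact_mod_cast hpos
  have hη'η : η' ≤ η := by rw [hN]; nlinarith
  have hθ : 0 ≤ θ := hη.le.trans hηθ
  set R : ℝ := (3 + C₀) * r with hR
  have hrR : r ≤ R := by rw [hR]; nlinarith
  have hR0 : 0 ≤ R := hr.trans hrR
  -- every fit inside `R·θ`: `rη ≤ rθ`, `rη′ ≤ rθ`, `C_π rη′ ≤ C₀ rθ`
  have hf1 : r * η ≤ r * θ := mul_le_mul_of_nonneg_left hηθ hr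
  have hf2 : r * η' ≤ r * θ := mul_le_mul_of_nonneg_left (hη'η.trans hηθ) hr
  have hf3 : Cπ * (r * η') ≤ C₀ * (r * θ) := by
    calc Cπ * (r * η') = r * (Cπ * η') := by ring
      _ ≤ r * (C₀ * θ) := mul_le_mul_of_nonneg_left hCθ hr
      _ = C₀ * (r * θ) := by ring
  have hRθ : r * θ + r * θ + C₀ * (r * θ) ≤ R * θ := by rw [hR]; nlinarith [mul_nonneg hr hθ]
  have hrθ0 : 0 ≤ r * θ := mul_nonneg hr hθ
  exact twoSidedLetters_of_gauge e hη' hη'η hη1 hηθ hR0 hr2 (fun μ x' => (h1 μ x').trans hrR) (fun μ x => (g1 μ x).trans hrR)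
    (fun μ x' => (g2' μ x').trans (mul_le_mul_of_nonneg_right hrR hη'.le)) (fun μ x => (g2 μ x).trans (mul_le_mul_of_nonneg_right hrR hη.le))
    (fun μ x' => (g3 μ x').trans (by nlinarith [hf3])) (fun μ x' => (g4 μ x').trans (by nlinarith [hf1, hf2, hf3])) (fun μ x' => (g5 μ x').trans (by nlinarith [hf1, hf3]))

end Gauge

end Summit.QuantumFields.YangMills.BalabanUVNodes.N15.BackgroundLayer

end
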